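import Summits.KontsevichZagierPeriods.KontsevichZagierPeriods.Theses.GenusOneIterated

/-!
# Crux `OffGenusOneSectorKernel` (stmt-KontsevichZagierPeriods-14449) — birth skeleton (`Lines/birth.lean`, BC3)

Route `GenusOneIterated`, rank-7 remainder crux `OffGenusOneSectorKernel` ("the rest of the summit
beyond the genus-one sector"): every formal `ℤ`-combination `c` of integral representations with
`KZ.eval c = 0` lies in `H := KZ.relations ⊔ closure (S_F ∪ S_L1 ∪ S_K ∪ S_L2)`, the relations of the
KZ calculus with the route's four typed genus-one relator families adjoined (integral form; the
deciding theorem `closes` consumes exactly this together with the four sector cruxes).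

The crux docstring names its content: "the transcendence side (AlgIndep{π, ϖ, log 2}) plus every
other sector of Conjecture 1, and the integrality of `P_KZ` modulo the sector span". The skeleton
cuts it along the two seams the tree already owns for Conjecture 1, so that each layer is a
statement of ONE kind of mathematics:

* `stub_boundedVolumeNormalForm` (real semialgebraic GEOMETRY inside the rules; provable-class,
  size M): every formal combination is congruent modulo `KZ.relations` to a difference `[A] − [B]`
  of two BOUNDED integrand-`1` representations of one common dimension — Viu-Sos' semi-canonical
  reduction [ViuSos2021, Thm. 1.1; CressonViusos2022, §1] run on a whole combination. Tools landed:
  `KZ.exists_sub_add_mem_relations_sign`, `KZ.exists_boundedVolume_sub_mem_relations` (sign split,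
  region under the graph, grounding, monomial compression: `[r] ≡ [A_r] − [B_r]` one dimension up —
  applied to an integrand-`1` representation it is also the dimension-raising slab), packing
  `KZ.exists_isCompact_of_sub_of_sub_mem_relations`; missing piece: merging finitely many bounded
  bodies of one dimension into one by rule-(2) translations with disjoint images and rule (1a).
* `stub_classicalSymbolInjective` (TRANSCENDENCE, conjecture-grade = Grothendieck–Kontsevich; the
  CONSTRUCTION is part of the claim, nothing is smuggled into an interface): the classical de
  Rham–Betti period datum over `ℚ` exists as an instance of the tree's hypothesis structures
  (`ClassicalPeriodDatum ℚ` with `KernelData`; Huber–Müller-Stach 2017, Ch. 3, §11) and carries Nori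
  symbol data `Ψ` for KZ representations (`KZ.NoriSymbolData`: HMS draft III Lemma 11.2.3 /
  Thm. 11.2.4 plus "moves are motivic", Rem. 12.1.7) on which the evaluation of effective formal
  periods is injective (`FormalPeriodEvalInjective`, Kontsevich's formal period conjecture, HMS 2017
  §13.2; Ayoub / Nori: ⟺ Grothendieck's period conjecture for all motives over `ℚ`). This is where
  `AlgIndep{π, ϖ, log 2}` (Chudnovsky 1976 for `{π, ϖ}`) and every other transcendence input live.
* `stub_motivicVolumesAccessible` (ACCESSIBILITY off the sector, conjecture-grade = HMS 2017
  Rem. 13.1.8 for volumes; the off-sector twin of the route's own crux `EllGeneration`): for every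
  classical period datum with kernel data and every Nori symbol data `Ψ`, two bounded integrand-`1`
  bodies of one dimension with the same Nori symbol, `Ψ([A] − [B]) = 0` — a MOTIVIC identity of
  volumes, "generalised Hilbert III with curved faces" — satisfy `[A] − [B] ∈ H`: the identity is a
  chain of moves modulo the four genus-one relator families. By (Ψ1) (`ev ∘ Ψ = eval`) this stub is
  implied by the crux in every model of the interfaces, so it is never stronger than the crux; it
  is the crux with the transcendence theory and the unbounded/signed-integrand bookkeeping removed.

Composition (`offGenusOneSectorKernel_of_stubs`, a real proof, ≈ 20 lines; the registered theorem
`OffGenusOneSectorKernel_of : OffGenusOneSectorKernel` feeds the three stubs in BY NAME): given `c`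
with `eval c = 0`, normalise `c ≡ [A] − [B] (mod relations)`; soundness of the moves
(`KZ.relations_le_ker_eval_holds`) gives `vol A = vol B`, i.e. `eval ([A] − [B]) = 0`; on the datum of
`stub_classicalSymbolInjective`, (Ψ1) turns this into `ev (Ψ([A] − [B])) = 0` and injectivity into
`Ψ([A] − [B]) = 0`; accessibility gives `[A] − [B] ∈ H`; and `relations ≤ H` climbs back to `c ∈ H`.
This is the factorisation `ker eval = Ψ⁻¹(ker ev) ⊆ ker Ψ ⊆ H` of Kontsevich–Zagier 2001 §4.1 /
HMS 2017 §13.1 (tree pattern: `KZ.kernel_subset_relations_of_isFaithful`,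
`GenusOneIterated.mem_relations_of_ellGeneration_of_formalPeriodEvalInjective`), run on Viu-Sos normal
forms and modulo the sector.

BC3 probes (registrar folder `bc/probe_*.lean`): for each stub, `stub → OffGenusOneSectorKernel` and
`stub → KontsevichZagierPeriods` by `first | exact? | simpa | aesop` FAIL (normal form has no kernel
content; the datum stub has no accessibility content; accessibility needs a datum on which `Ψ c = 0`
follows from `eval c = 0`). Disproof used: none on record (`ledger crux ls stmt-KontsevichZagierPeriods-14449`:
no workfiles before this one; negatives index of the summit: one entry, KinematicPlaneConvex via
`K = ∅`, unrelated — the stubs are checked on degenerate data: `c = 0 ↦ A = B`, `A = B ↦ 0 ∈ H`).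
Sorries live ONLY in the three `stub_*` theorems.
-/

noncomputable section

set_option linter.dupNamespace false

open Literature.NumberTheory.Transcendental
open Literature.AlgebraicGeometry.Motives (ClassicalPeriodDatum)
open Summit.KontsevichZagierPeriods.KontsevichZagierPeriods.Theses.GenusOneIterated (OffGenusOneSectorKernel)

namespace Summit.KontsevichZagierPeriods.KontsevichZagierPeriods.Cruxes.OffGenusOneSectorKernel.Birth

/-! ### Registered stubs -/

/-- **STUB N — `boundedVolumeNormalForm` (geometry inside the rules; provable-class, size M).**
Every formal `ℤ`-combination of integral representations is congruent, modulo `KZ.relations`, to a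
difference `[A] − [B]` of two representations of ONE common dimension with BOUNDED `ℚ`-semialgebraic
domains and integrand `1` on them (two bounded semialgebraic bodies). Plan: `FreeAbelianGroup`
induction; a generator `[r]` is `[A_r] − [B_r]` one dimension up by
`KZ.exists_sub_add_mem_relations_sign` + `KZ.exists_boundedVolume_sub_mem_relations`; dimensions are
equalised by the same lemma applied to integrand-`1` bodies (slab `× [0,1]`, one dimension at a
time); sums are merged by rule-(2) translations with pairwise disjoint bounded images and rule (1a);
negation swaps `A` and `B`; `c = 0` is `A = B`. [ViuSos2021 Thm. 1.1; CressonViusos2022 §1;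
KontsevichZagier2001 §1.2 rules (1), (2), (3)] -/
theorem stub_boundedVolumeNormalForm :
    ∀ c : KZ.FormalRep, ∃ (m : ℕ) (A B : KZ.IntegralRep m),
      Bornology.IsBounded A.domain ∧ Bornology.IsBounded B.domain ∧
      (∀ z ∈ A.domain, A.integrand z = 1) ∧ (∀ z ∈ B.domain, B.integrand z = 1) ∧
      c - (KZ.of A - KZ.of B) ∈ KZ.relations := by
  sorry

/-- **STUB T — `classicalSymbolInjective` (transcendence; construction + conjecture, GPC-strength).**
There is a classical period datum over `ℚ` with kernel data (the de Rham–Betti cohomology of pairs,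
comparison pairing, connecting morphisms, relative exactness on normal-crossings pairs — HMS 2017
Ch. 3, §11; draft I §3) carrying Nori symbol data `Ψ` for the Kontsevich–Zagier calculus (every
representation has a symbol `(X, D, ω, γ)` with the right period and dimension, and every instance of
the four moves is a formal-period relation: HMS draft III Lemma 11.2.3, Thm. 11.2.4, Rem. 12.1.7) on
which the evaluation `ev : 𝒫̃⁺ → ℂ` of effective formal periods is INJECTIVE (Kontsevich's formal
period conjecture for the classical datum, HMS 2017 Def. 13.1.1 / §13.2; equivalent to
Grothendieck's period conjecture for Nori motives over `ℚ`). Why it might fail: only if periods of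
`ℚ`-varieties satisfy a non-motivic algebraic relation (no candidate is known), or — for the
construction half — if some KZ move is not a formal-period relation (HMS Rem. 12.1.7, believed).
[Kontsevich1999 §4; KontsevichZagier2001 §4.1; HuberMullerStach2017 §13; Ayoub2014; Chudnovsky1976] -/
theorem stub_classicalSymbolInjective :
    ∃ 𝒞 : ClassicalPeriodDatum ℚ, 𝒞.KernelData ∧ Nonempty (𝒞.NoriSymbolData (Rat.castHom ℂ)) ∧
      FormalPeriodEvalInjective 𝒞.R 𝒞.B (Rat.castHom ℂ) := by
  sorry

/-- **STUB A — `motivicVolumesAccessible` (accessibility off the genus-one sector; conjecture-grade,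
HMS 2017 Rem. 13.1.8 for bounded volumes).** For every classical period datum over `ℚ` with kernel
data and every Nori symbol data `Ψ` on it: if two bounded integrand-`1` representations `A`, `B` of
one dimension have the same Nori symbol, `Ψ([A] − [B]) = 0` in the effective formal periods (a
MOTIVIC identity between the volumes of two bounded `ℚ`-semialgebraic bodies), then `[A] − [B]`
lies in `KZ.relations ⊔ closure (S_F ∪ S_L1 ∪ S_K ∪ S_L2)` — the identity is a finite chain of
moves modulo the route's four genus-one relator families (verbatim the subgroup of the crux). The
off-sector twin of crux `EllGeneration`; implied by the crux in every model (Ψ1: `Ψ y = 0 ⇒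
eval y = 0`). Why it might fail: one motivic volume identity — an isogeny/correspondence period
relation in Hodge level ≥ 2, a cusp/B-period identity of another genus-one family — with no chain
of absolutely convergent real moves even modulo the four adjoined families.
[HuberMullerStach2017 Rem. 13.1.8; KontsevichZagier2001 §1.2; CressonViusos2022 §1] -/
theorem stub_motivicVolumesAccessible :
    ∀ 𝒞 : ClassicalPeriodDatum ℚ, 𝒞.KernelData →
      ∀ (Ψ : 𝒞.NoriSymbolData (Rat.castHom ℂ)) (m : ℕ) (A B : KZ.IntegralRep m),
        Bornology.IsBounded A.domain → Bornology.IsBounded B.domain →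
        (∀ z ∈ A.domain, A.integrand z = 1) → (∀ z ∈ B.domain, B.integrand z = 1) →
        KZ.noriSymbol Ψ (KZ.of A - KZ.of B) = 0 →
        KZ.of A - KZ.of B ∈ KZ.relations ⊔ AddSubgroup.closure ({d : KZ.FormalRep | ∃ (e₁ e₂ e₃ : ℝ) (r : KZ.IntegralRep 3) (rA rB rA' rL : KZ.IntegralRep 1), IsAlgebraic ℚ e₁ ∧ IsAlgebraic ℚ e₂ ∧ IsAlgebraic ℚ e₃ ∧ e₃ < e₂ ∧ e₂ < e₁ ∧ e₁ + e₂ + e₃ = 0 ∧ r.domain = {x | e₃ < x 0 ∧ x 0 < x 1 ∧ x 1 < x 2 ∧ x 2 < e₂} ∧ Set.EqOn r.integrand (fun x => x 2 / (Real.sqrt (4 * (x 0 - e₁) * (x 0 - e₂) * (x 0 - e₃)) * Real.sqrt (4 * (x 1 - e₁) * (x 1 - e₂) * (x 1 - e₃)) * Real.sqrt (4 * (x 2 - e₁) * (x 2 - e₂) * (x 2 - e₃)))) r.domain ∧ rA.domain = {x | e₃ < x 0 ∧ x 0 < e₂} ∧ Set.EqOn rA.integrand (fun x => 1 / Real.sqrt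 (4 * (x 0 - e₁) * (x 0 - e₂) * (x 0 - e₃))) rA.domain ∧ rB.domain = {x | e₃ < x 0 ∧ x 0 < e₂} ∧ Set.EqOn rB.integrand (fun x => x 0 / Real.sqrt (4 * (x 0 - e₁) * (x 0 - e₂) * (x 0 - e₃))) rB.domain ∧ rA'.domain = {x | e₂ < x 0 ∧ x 0 < e₁} ∧ Set.EqOn rA'.integrand (fun x => 1 / Real.sqrt (-(4 * (x 0 - e₁) * (x 0 - e₂) * (x 0 - e₃)))) rA'.domain ∧ rL.domain = {x | 0 < x 0 ∧ x 0 < 1} ∧ Set.EqOn rL.integrand (fun x => 16 / (1 + x 0) + 8 * (e₁ - e₃ - 1) / (1 + (e₁ - e₃ - 1) * x 0) - 4 * (e₁ - e₂ - 1) / (1 + (e₁ - e₂ - 1) * x 0) - 4 * (e₂ - e₃ - 1) / (1 + (e₂ - e₃ - 1) * x 0)) rL.domain ∧ d = 48 • KZ.of r - 8 • (KZ.of rA * KZ.of rA * KZ.of rB) + 4 • (KZ.of KZ.piRep * KZ.of rA') - KZ.of rA * KZ.of rL} ∪ {d : KZ.FormalRep | ∃ (r : KZ.IntegralRep 3) (r'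 : KZ.IntegralRep 2), r.domain = {x | -1 < x 0 ∧ x 0 < x 1 ∧ x 1 < x 2 ∧ x 2 < 0} ∧ Set.EqOn r.integrand (fun x => 8 * x 2 / (Real.sqrt (4 * x 0 ^ 3 - 4 * x 0) * Real.sqrt (4 * x 1 ^ 3 - 4 * x 1) * Real.sqrt (4 * x 2 ^ 3 - 4 * x 2))) r.domain ∧ r'.domain = {x | -1 < x 0 ∧ x 0 < 0 ∧ 0 < x 1 ∧ x 1 < 1} ∧ Set.EqOn r'.integrand (fun x => (4 / (1 + x 1) - 4 / (1 + x 1 ^ 2)) / Real.sqrt (4 * x 0 ^ 3 - 4 * x 0)) r'.domain ∧ d = KZ.of r - KZ.of r'} ∪ {d : KZ.FormalRep | ∃ (r : KZ.IntegralRep 2) (r' : KZ.IntegralRep 1), r.domain = {x | -1 < x 0 ∧ x 0 < x 1 ∧ x 1 < 0} ∧ Set.EqOn r.integrand (fun x => (x 1 - x 0) / (Real.sqrt (4 * x 0 ^ 3 - 4 * x 0) * Real.sqrt (4 * x 1 ^ 3 - 4 * x 1))) r.domain ∧ r'.domain = {x | 1 < x 0 ∧ x 0 < 2} ∧ Set.EqOn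 r'.integrand (fun x => 1 / (2 * x 0)) r'.domain ∧ d = KZ.of r - KZ.of r'} ∪ {d : KZ.FormalRep | ∃ (r : KZ.IntegralRep 4) (r' : KZ.IntegralRep 2), r.domain = {x | -1 < x 0 ∧ x 0 < 0 ∧ -1 < x 1 ∧ x 1 < x 2 ∧ x 2 < x 3 ∧ x 3 < 0} ∧ Set.EqOn r.integrand (fun x => 32 * x 2 * x 3 / (Real.sqrt (4 * x 0 ^ 3 - 4 * x 0) * Real.sqrt (4 * x 1 ^ 3 - 4 * x 1) * Real.sqrt (4 * x 2 ^ 3 - 4 * x 2) * Real.sqrt (4 * x 3 ^ 3 - 4 * x 3))) r.domain ∧ r'.domain = {x | 0 < x 0 ∧ x 0 < 1 ∧ 0 < x 1 ∧ x 1 < 1} ∧ Set.EqOn r'.integrand (fun x => 4 / (1 + x 0 ^ 2) * (4 / (1 + x 1 ^ 2) + 2 / (1 + x 1) - 4)) r'.domain ∧ d = KZ.of r - KZ.of r'}) := by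
  sorry

/-! ### Composition (no `sorry` below this line) -/

/-- **(Ψ1) + injectivity of `ev`: numerical relations are motivic.** On a classical period datum
carrying Nori symbol data `Ψ` with `ev` injective on the effective formal periods, a formal
combination of integral representations with value `0` has Nori symbol `0`:
`eval y = 0 ⇒ ev (Ψ y) = 0 ⇒ Ψ y = 0` (Kontsevich–Zagier 2001 §4.1; Huber–Müller-Stach 2017 §13.1;
the first half of `KZ.kernel_subset_relations_of_isFaithful`). Sorry-free helper of the composition.
[folklore] -/
theorem noriSymbol_eq_zero_of_eval_eq_zero (𝒞 : ClassicalPeriodDatum ℚ)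
    (Ψ : 𝒞.NoriSymbolData (Rat.castHom ℂ))
    (hinj : FormalPeriodEvalInjective 𝒞.R 𝒞.B (Rat.castHom ℂ)) {y : KZ.FormalRep}
    (hy : KZ.eval y = 0) : KZ.noriSymbol Ψ y = 0 := by
  have h1 : Literature.AlgebraicGeometry.Motives.AlongHom.equiv (Rat.castHom ℂ)
      (formalPeriodEval 𝒞.R (Rat.castHom ℂ) (Ψ.symbol y)) = 0 := by
    rw [Ψ.eval_symbol y, hy]
    simp
  have h2 : formalPeriodEval 𝒞.R (Rat.castHom ℂ) (Ψ.symbol y) = 0 := by simpa using h1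
  rw [KZ.noriSymbol_apply, Submodule.mkQ_apply, Submodule.Quotient.mk_eq_zero]
  exact hinj _ h2


set_option linter.defProp false in
/-- **Composition, hypotheses form (pure logic + soundness of the moves + (Ψ1)).** The three stub
STATEMENTS imply the crux BY NAME: normalise `c ≡ [A] − [B]`, read `vol A = vol B` off soundness
(`KZ.relations_le_ker_eval_holds`), transport it to `Ψ([A] − [B]) = 0` on the datum of the
transcendence stub ((Ψ1) `KZ.SymbolMap.eval_symbol` and injectivity of `ev`), apply accessibility,
and climb back along `KZ.relations ≤ H`. Declared as a `def` so that `OffGenusOneSectorKernel_of`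
below is the unique theorem of this file concluding the crux (skeleton audit). [folklore] -/
def offGenusOneSectorKernel_of_stubs :
    (∀ c : KZ.FormalRep, ∃ (m : ℕ) (A B : KZ.IntegralRep m),
      Bornology.IsBounded A.domain ∧ Bornology.IsBounded B.domain ∧
      (∀ z ∈ A.domain, A.integrand z = 1) ∧ (∀ z ∈ B.domain, B.integrand z = 1) ∧
      c - (KZ.of A - KZ.of B) ∈ KZ.relations) →
    (∃ 𝒞 : ClassicalPeriodDatum ℚ, 𝒞.KernelData ∧ Nonempty (𝒞.NoriSymbolData (Rat.castHom ℂ)) ∧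
      FormalPeriodEvalInjective 𝒞.R 𝒞.B (Rat.castHom ℂ)) →
    (∀ 𝒞 : ClassicalPeriodDatum ℚ, 𝒞.KernelData →
      ∀ (Ψ : 𝒞.NoriSymbolData (Rat.castHom ℂ)) (m : ℕ) (A B : KZ.IntegralRep m),
        Bornology.IsBounded A.domain → Bornology.IsBounded B.domain →
        (∀ z ∈ A.domain, A.integrand z = 1) → (∀ z ∈ B.domain, B.integrand z = 1) →
        KZ.noriSymbol Ψ (KZ.of A - KZ.of B) = 0 →
        KZ.of A - KZ.of B ∈ KZ.relations ⊔ AddSubgroup.closure ({d : KZ.FormalRep | ∃ (e₁ e₂ e₃ : ℝ) (r : KZ.IntegralRep 3) (rA rB rA' rL : KZ.IntegralRep 1), IsAlgebraic ℚ e₁ ∧ IsAlgebraic ℚ e₂ ∧ IsAlgebraic ℚ e₃ ∧ e₃ < e₂ ∧ e₂ < e₁ ∧ e₁ + e₂ + e₃ = 0 ∧ r.domain = {x | e₃ < x 0 ∧ x 0 < x 1 ∧ x 1 < x 2 ∧ x 2 < e₂} ∧ Set.EqOn r.integrand (fun x => x 2 / (Real.sqrt (4 * (x 0 - e₁) * (x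 0 - e₂) * (x 0 - e₃)) * Real.sqrt (4 * (x 1 - e₁) * (x 1 - e₂) * (x 1 - e₃)) * Real.sqrt (4 * (x 2 - e₁) * (x 2 - e₂) * (x 2 - e₃)))) r.domain ∧ rA.domain = {x | e₃ < x 0 ∧ x 0 < e₂} ∧ Set.EqOn rA.integrand (fun x => 1 / Real.sqrt (4 * (x 0 - e₁) * (x 0 - e₂) * (x 0 - e₃))) rA.domain ∧ rB.domain = {x | e₃ < x 0 ∧ x 0 < e₂} ∧ Set.EqOn rB.integrand (fun x => x 0 / Real.sqrt (4 * (x 0 - e₁) * (x 0 - e₂) * (x 0 - e₃))) rB.domain ∧ rA'.domain = {x | e₂ < x 0 ∧ x 0 < e₁} ∧ Set.EqOn rA'.integrand (fun x => 1 / Real.sqrt (-(4 * (x 0 - e₁) * (x 0 - e₂) * (x 0 - e₃)))) rA'.domain ∧ rL.domain = {x | 0 < x 0 ∧ x 0 < 1} ∧ Set.EqOn rL.integrand (fun x => 16 / (1 + x 0) + 8 * (e₁ - e₃ - 1) / (1 + (e₁ - e₃ - 1) * x 0) - 4 * (e₁ - e₂ - 1) / (1 + (e₁ - e₂ - 1)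 * x 0) - 4 * (e₂ - e₃ - 1) / (1 + (e₂ - e₃ - 1) * x 0)) rL.domain ∧ d = 48 • KZ.of r - 8 • (KZ.of rA * KZ.of rA * KZ.of rB) + 4 • (KZ.of KZ.piRep * KZ.of rA') - KZ.of rA * KZ.of rL} ∪ {d : KZ.FormalRep | ∃ (r : KZ.IntegralRep 3) (r' : KZ.IntegralRep 2), r.domain = {x | -1 < x 0 ∧ x 0 < x 1 ∧ x 1 < x 2 ∧ x 2 < 0} ∧ Set.EqOn r.integrand (fun x => 8 * x 2 / (Real.sqrt (4 * x 0 ^ 3 - 4 * x 0) * Real.sqrt (4 * x 1 ^ 3 - 4 * x 1) * Real.sqrt (4 * x 2 ^ 3 - 4 * x 2))) r.domain ∧ r'.domain = {x | -1 < x 0 ∧ x 0 < 0 ∧ 0 < x 1 ∧ x 1 < 1} ∧ Set.EqOn r'.integrand (fun x => (4 / (1 + x 1) - 4 / (1 + x 1 ^ 2)) / Real.sqrt (4 * x 0 ^ 3 - 4 * x 0)) r'.domain ∧ d = KZ.of r - KZ.of r'} ∪ {d : KZ.FormalRep | ∃ (r : KZ.IntegralRep 2) (r' : KZ.IntegralRep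 1), r.domain = {x | -1 < x 0 ∧ x 0 < x 1 ∧ x 1 < 0} ∧ Set.EqOn r.integrand (fun x => (x 1 - x 0) / (Real.sqrt (4 * x 0 ^ 3 - 4 * x 0) * Real.sqrt (4 * x 1 ^ 3 - 4 * x 1))) r.domain ∧ r'.domain = {x | 1 < x 0 ∧ x 0 < 2} ∧ Set.EqOn r'.integrand (fun x => 1 / (2 * x 0)) r'.domain ∧ d = KZ.of r - KZ.of r'} ∪ {d : KZ.FormalRep | ∃ (r : KZ.IntegralRep 4) (r' : KZ.IntegralRep 2), r.domain = {x | -1 < x 0 ∧ x 0 < 0 ∧ -1 < x 1 ∧ x 1 < x 2 ∧ x 2 < x 3 ∧ x 3 < 0} ∧ Set.EqOn r.integrand (fun x => 32 * x 2 * x 3 / (Real.sqrt (4 * x 0 ^ 3 - 4 * x 0) * Real.sqrt (4 * x 1 ^ 3 - 4 * x 1) * Real.sqrt (4 * x 2 ^ 3 - 4 * x 2) * Real.sqrt (4 * x 3 ^ 3 - 4 * x 3))) r.domain ∧ r'.domain = {x | 0 < x 0 ∧ x 0 < 1 ∧ 0 < x 1 ∧ x 1 < 1} ∧ Set.EqOn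 r'.integrand (fun x => 4 / (1 + x 0 ^ 2) * (4 / (1 + x 1 ^ 2) + 2 / (1 + x 1) - 4)) r'.domain ∧ d = KZ.of r - KZ.of r'})) →
    OffGenusOneSectorKernel := by
  intro hN hT hA c hc
  -- Viu-Sos normal form of the whole combination: `c ≡ [A] − [B]` modulo the moves
  obtain ⟨m, A, B, hAb, hBb, hA1, hB1, hcAB⟩ := hN c
  -- the classical datum with its Nori symbol, `ev` injective on its effective formal periods
  obtain ⟨𝒞, h𝒞, ⟨Ψ⟩, hinj⟩ := hT
  -- soundness of the moves: `eval ([A] − [B]) = eval c = 0`, i.e. `vol A = vol B`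
  have h0 : KZ.eval (KZ.of A - KZ.of B) = 0 := by
    have h : KZ.eval (c - (KZ.of A - KZ.of B)) = 0 := KZ.relations_le_ker_eval_holds hcAB
    rw [map_sub, hc, zero_sub, neg_eq_zero] at h
    exact h
  -- (Ψ1) + injectivity of `ev`: the identity `vol A = vol B` is motivic, `Ψ([A] − [B]) = 0`
  have hΨ : KZ.noriSymbol Ψ (KZ.of A - KZ.of B) = 0 := noriSymbol_eq_zero_of_eval_eq_zero 𝒞 Ψ hinj h0
  -- accessibility modulo the sector, then climb back along `relations ≤ relations ⊔ closure S`
  have hsum : c - (KZ.of A - KZ.of B) + (KZ.of A - KZ.of B) ∈ _ :=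
    add_mem (AddSubgroup.mem_sup_left hcAB) (hA 𝒞 h𝒞 Ψ m A B hAb hBb hA1 hB1 hΨ)
  rwa [sub_add_cancel] at hsum

/-- **Skeleton theorem (registered form).** The crux `OffGenusOneSectorKernel` BY NAME from the three
declared stubs, via the sorry-free composition `offGenusOneSectorKernel_of_stubs`; `sorry` occurs only
inside `stub_boundedVolumeNormalForm`, `stub_classicalSymbolInjective`, `stub_motivicVolumesAccessible`. -/
theorem OffGenusOneSectorKernel_of : OffGenusOneSectorKernel :=
  offGenusOneSectorKernel_of_stubs stub_boundedVolumeNormalForm stub_classicalSymbolInjective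
    stub_motivicVolumesAccessible

end Summit.KontsevichZagierPeriods.KontsevichZagierPeriods.Cruxes.OffGenusOneSectorKernel.Birth

end
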